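import Summits.ABC.ABC.Theorems.TwistAmplificationSharpModerateLawCuspTransferCone
import Summits.ABC.ABC.Theorems.TwistAmplificationSharpModerateLawSyzygyTransferCone
import Summits.ABC.ABC.Theorems.TwistAmplificationSharpModerateLawLatticeHalf
import Summits.ABC.ABC.Theorems.TwistAmplificationSharpModerateLawFieldSum
import Summits.ABC.ABC.Theorems.TwistAmplificationSharpModerateLawFewDeepOfLattice

/-!
# Crux `TwistAmplification.SharpModerateLaw` (stmt-ABC-1975), line `syzygy-lattice-half-deep-few-primes`:
the line's reduction theorem

Assembling the landed stubs of the line: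

* `fewDeepLaw_of_uniformity` — **the few-deep-primes law** for index-form data over maximal cubic rings
  (`FewDeepLaw`: `totalCount FewDeep X Y ≤ C_ε (XY)^ε · X·Y^{-1/6}` for all `X, Y ≥ 1`), conditional ONLY on the named
  Literature fact `btt_uniformity_sqDvd` (Bhargava–Taniguchi–Thorne 2023 Prop. 4.5 uniformity estimate): Kane's lattice half
  (`stub_latticeHalf`) + the field sum (`stub_fieldSum`) assembled by `stub_fewDeepOfLattice`;
* `sharpModerateLaw_of_uniformity_of_spreadLawCone` — **the crux reduced to its open core**:
  `btt_uniformity_sqDvd → SpreadLawCone → SharpModerateLaw` (cone cusp transfer `cuspTransferCone`, cone dictionary step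
  `syzygyTransferCone`, cone split), registered sub-goal of stmt-ABC-1975;
* `sharpModerateLaw_of_uniformity_of_spreadLaw` — the same with the unrestricted two-parameter `SpreadLaw`;
* `cuspShellLaw_of_uniformity_of_spreadLaw` — the full two-parameter cusp shell law from the same two inputs.

So `SharpModerateLaw` (hence, via the route, the moderate-window counting target) follows from one published theorem not yet in
the tree and ONE open statement, the cone-restricted spread law for index forms of maximal cubic rings.
-/

noncomputable section

namespace Summit.ABC.ABC.Theorems.SharpModerateLaw

/-- **Few-deep-primes law** (conditional on the BTT uniformity estimate): for every `ε > 0` there is `C` with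
`totalCount FewDeep X Y ≤ C (XY)^ε X Y^{-1/6}` for all `X, Y ≥ 1` — the count, over all maximal cubic rings of discriminant
`0 < |D| ≤ 2Y` and their index-form shells at conductor budget `X` and dyadic level `Y`, of the data whose depth carrier
`g·rad(D)·v(F(q₀))` is at most `X·Y^{-1/6}`. -/
theorem fewDeepLaw_of_uniformity : Literature.NumberTheory.CubicFields.btt_uniformity_sqDvd → FewDeepLaw :=
  fun hU => stub_fewDeepOfLattice stub_latticeHalf (stub_fieldSum hU)

/-- **The crux reduced to its open core** (registered sub-goal `sharpModerateLaw_of_uniformity_of_spreadLawCone`):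
the BTT uniformity estimate and the cone-restricted spread law imply `SharpModerateLaw`. -/
theorem sharpModerateLaw_of_uniformity_of_spreadLawCone : Literature.NumberTheory.CubicFields.btt_uniformity_sqDvd → SpreadLawCone → Summit.ABC.ABC.Theses.TwistAmplification.SharpModerateLaw :=
  fun hU hSp => sharpModerateLaw_of_coneCore cuspTransferCone syzygyTransferCone (fewDeepLaw_of_uniformity hU) hSp

/-- The same reduction with the unrestricted two-parameter spread law `SpreadLaw` (which implies `SpreadLawCone`). -/
theorem sharpModerateLaw_of_uniformity_of_spreadLaw :
    Literature.NumberTheory.CubicFields.btt_uniformity_sqDvd → SpreadLaw →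
      Summit.ABC.ABC.Theses.TwistAmplification.SharpModerateLaw :=
  fun hU h => sharpModerateLaw_of_uniformity_of_spreadLawCone hU (spreadLaw_implies_cone h)

/-- The full two-parameter cusp shell law for `(c₄, c₆)` pairs follows from the BTT uniformity estimate and the unrestricted
spread law (`stub_syzygyTransfer` with the few-deep/spread split inlined). -/
theorem cuspShellLaw_of_uniformity_of_spreadLaw :
    Literature.NumberTheory.CubicFields.btt_uniformity_sqDvd → SpreadLaw → CuspShellLaw := by
  intro hU hSp
  refine stub_syzygyTransfer ?_
  intro ε hε
  obtain ⟨C₁, hC₁⟩ := fewDeepLaw_of_uniformity hU ε hε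
  obtain ⟨C₂, hC₂⟩ := hSp ε hε
  refine ⟨max C₁ 0 + max C₂ 0, fun X Y hX hY => ?_⟩
  have hX0 : 0 < X := by linarith
  have hY0 : 0 < Y := by linarith
  have h1 := hC₁ X Y hX hY
  have h2 := hC₂ X Y hX hY
  have hsplit : (totalCount (fun _ _ _ _ => True) X Y : ℝ) ≤
      (totalCount FewDeep X Y : ℝ) + (totalCount (fun X Y F q => ¬ FewDeep X Y F q) X Y : ℝ) := by
    exact_mod_cast totalCount_le_split' X Y
  set E : ℝ := (X * Y) ^ ε with hE_def
  set A : ℝ := X * Y ^ (-(1 / 6 : ℝ)) with hA_def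
  have hE : 0 ≤ E := Real.rpow_nonneg (by positivity) ε
  have hA : 0 ≤ A := by positivity
  have s1 : C₁ * E * (A + 0) ≤ max C₁ 0 * E * (A + 1) := by
    have t1 : C₁ * E * (A + 0) ≤ max C₁ 0 * E * (A + 0) :=
      mul_le_mul_of_nonneg_right (mul_le_mul_of_nonneg_right (le_max_left _ _) hE) (by linarith)
    have t2 : max C₁ 0 * E * (A + 0) ≤ max C₁ 0 * E * (A + 1) :=
      mul_le_mul_of_nonneg_left (by linarith) (mul_nonneg (le_max_right _ _) hE)
    linarith
  have s2 : C₂ * E * (A + 1) ≤ max C₂ 0 * E * (A + 1) :=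
    mul_le_mul_of_nonneg_right (mul_le_mul_of_nonneg_right (le_max_left _ _) hE) (by linarith)
  calc (totalCount (fun _ _ _ _ => True) X Y : ℝ)
      ≤ (totalCount FewDeep X Y : ℝ) + (totalCount (fun X Y F q => ¬ FewDeep X Y F q) X Y : ℝ) := hsplit
    _ ≤ C₁ * E * (A + 0) + C₂ * E * (A + 1) := add_le_add h1 h2
    _ ≤ max C₁ 0 * E * (A + 1) + max C₂ 0 * E * (A + 1) := add_le_add s1 s2
    _ = (max C₁ 0 + max C₂ 0) * E * (A + 1) := by ring

end Summit.ABC.ABC.Theorems.SharpModerateLaw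

end
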